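import Literature.Analysis.UnboundedOperators.DiagonalOperator
import Mathlib.Analysis.Normed.Operator.Compact.Basic
import Mathlib.Analysis.RCLike.Lemmas
import HarnessLib

/-!
# A diagonal operator whose symbol tends to zero is compact

Topic `Literature/Analysis/UnboundedOperators`; companion of `DiagonalOperator.lean`
(`b.diagonalCLM m = Σ m i ⟪b i, ·⟫ b i` for a Hilbert basis `b` and a bounded symbol `m ∈ ℓ^∞`).
**Theorem** (`HilbertBasis.isCompactOperator_diagonalCLM_of_tendsto_zero`): if `m i → 0` along the
cofinite filter, then `diag(m)` is a compact operator (Halmos, *A Hilbert Space Problem Book*,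
Problem 171 "a diagonal operator is compact iff its diagonal tends to `0`"; Reed–Simon I, Thm. VI.12
with Thm. VI.13: norm limits of finite-rank operators are compact). Proof: for `ε > 0` the finitely
many indices with `|m i| ≥ ε` carry the finite-rank operator `S_ε = Σ_{|m i| ≥ ε} m i ⟪b i, ·⟫ b i`
(a finite sum of rank-one operators, each compact since it factors through the scalars), and
`‖diag(m) - S_ε‖ ≤ ε` (coordinates); Mathlib's `isCompactOperator_of_tendsto` concludes.

This is the abstract form of **Rellich's compactness on the torus**: in the Fourier basis the
embedding `H¹(𝕋ᵈ) ↪ L²(𝕋ᵈ)` is the diagonal operator with symbol `(1 + 4π²|k|²)^{-1/2} → 0`, so it is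
compact — the hypothesis of the form spectral theorem
`Literature.Analysis.OperatorTheory.exists_hilbertBasis_form_hasSum` for `-Δ + V` on a torus.
No definitions, no named facts; dot-notation extensions in Mathlib's `namespace HilbertBasis` as in
`DiagonalOperator.lean`.

## References

* P. R. Halmos, *A Hilbert Space Problem Book*, 2nd ed. (1982), Problem 171. [folklore form]
* M. Reed, B. Simon, *Methods of Modern Mathematical Physics I* (1980), Thm. VI.12–VI.13. [ReedSimonI1980]
-/

noncomputable section

open Filter Topology
open scoped InnerProductSpace

namespace HilbertBasis

variable {ι 𝕜 H : Type*} [RCLike 𝕜] [NormedAddCommGroup H] [InnerProductSpace 𝕜 H]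
variable (b : HilbertBasis ι 𝕜 H)

/-- (Dot-notation extension of Mathlib's `HilbertBasis`, but about any vectors.) **Rank-one operators
are compact**: `x ↦ ⟪u, x⟫ v` factors through the (locally compact) scalar field. [folklore] -/
theorem isCompactOperator_smulRight_inner (u v : H) :
    IsCompactOperator ((innerSL 𝕜 u).smulRight v) := by
  have h1 : IsCompactOperator (innerSL 𝕜 u : H → 𝕜) :=
    isCompactOperator_of_locallyCompactSpace_dom (innerSL 𝕜 u)
  have h2 := h1.clm_comp (ContinuousLinearMap.toSpanSingleton 𝕜 v)
  have heq : ((ContinuousLinearMap.toSpanSingleton 𝕜 v) ∘ (innerSL 𝕜 u : H → 𝕜)) =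
      ⇑((innerSL 𝕜 u).smulRight v) := by
    funext x
    simp [ContinuousLinearMap.toSpanSingleton_apply, ContinuousLinearMap.smulRight_apply]
  rwa [heq] at h2

/-- A finite sum of rank-one operators along the basis, `Σ_{i ∈ F} m i ⟪b i, ·⟫ b i`, is compact.
[folklore] -/
theorem isCompactOperator_sum_smulRight (m : ι → 𝕜) (F : Finset ι) :
    IsCompactOperator
      (⇑(∑ i ∈ F, m i • (innerSL 𝕜 (b i)).smulRight (b i) : H →L[𝕜] H)) := by
  classical
  induction F using Finset.induction_on with
  | empty =>
    rw [Finset.sum_empty, FunLike.coe_zero]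
    exact isCompactOperator_zero
  | insert i F hi ih =>
    rw [Finset.sum_insert hi, FunLike.coe_add, FunLike.coe_smul]
    exact ((isCompactOperator_smulRight_inner (b i) (b i)).smul (m i)).add ih

/-- Coordinates of the finite-rank truncation: `⟪b j, Σ_{i ∈ F} m i ⟪b i, x⟫ b i⟫ = [j ∈ F] m j ⟪b j, x⟫`.
[folklore] -/
theorem inner_sum_smulRight_apply [DecidableEq ι] (m : ι → 𝕜) (F : Finset ι) (x : H) (j : ι) :
    ⟪b j, (∑ i ∈ F, m i • (innerSL 𝕜 (b i)).smulRight (b i) : H →L[𝕜] H) x⟫_𝕜 =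
      if j ∈ F then m j * ⟪b j, x⟫_𝕜 else 0 := by
  rw [FunLike.coe_sum, Finset.sum_apply, inner_sum]
  have hterm : ∀ i, ⟪b j, (m i • (innerSL 𝕜 (b i)).smulRight (b i) : H →L[𝕜] H) x⟫_𝕜 =
      if j = i then m j * ⟪b j, x⟫_𝕜 else 0 := fun i => by
    rw [FunLike.coe_smul, Pi.smul_apply, ContinuousLinearMap.smulRight_apply,
      innerSL_apply_apply, smul_smul, inner_smul_right, orthonormal_iff_ite.1 b.orthonormal j i]
    split_ifs with h
    · subst h; ring
    · ring
  simp_rw [hterm]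
  rw [Finset.sum_ite_eq]

/-- (Dot-notation extension of Mathlib's `HilbertBasis`.) **A diagonal operator whose symbol tends to
zero is compact** (Halmos, Problem 171; Reed–Simon I, Thm. VI.12–13): if `m ∈ ℓ^∞(ι)` satisfies
`m i → 0` along the cofinite filter, then `b.diagonalCLM m` is a compact operator. In the Fourier basis
of a torus this is Rellich's theorem `H¹ ↪ L²` compact (symbol `(1 + 4π²|k|²)^{-1/2}`).
[cite: ReedSimonI1980, Thm. VI.12–VI.13] -/
theorem isCompactOperator_diagonalCLM_of_tendsto_zero [CompleteSpace H] (m : lp (fun _ : ι => 𝕜) ⊤)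
    (hm : Tendsto (fun i => ‖m i‖) cofinite (𝓝 0)) :
    IsCompactOperator (b.diagonalCLM m) := by
  classical
  -- finite-rank approximants `S k` with `‖diag(m) - S k‖ ≤ 1/(k+1)`
  have happrox : ∀ ε : ℝ, 0 < ε → ∃ S : H →L[𝕜] H, IsCompactOperator S ∧ ‖b.diagonalCLM m - S‖ ≤ ε := by
    intro ε hε
    have hfin : {i | ε ≤ ‖m i‖}.Finite := by
      have h := (Metric.tendsto_nhds.1 hm) ε hε
      simp only [dist_zero_right, norm_norm, eventually_cofinite, not_lt] at h
      exact h
    set F : Finset ι := hfin.toFinset with hF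
    have hmemF : ∀ i, i ∈ F ↔ ε ≤ ‖m i‖ := fun i => by simp [hF]
    refine ⟨∑ i ∈ F, m i • (innerSL 𝕜 (b i)).smulRight (b i), b.isCompactOperator_sum_smulRight m F,
      ?_⟩
    refine ContinuousLinearMap.opNorm_le_bound _ hε.le fun x => ?_
    -- coordinates of the difference: `[j ∉ F] m j ⟪b j, x⟫`, of modulus `≤ ε |⟪b j, x⟫|`
    set y : H := (b.diagonalCLM m - ∑ i ∈ F, m i • (innerSL 𝕜 (b i)).smulRight (b i)) x with hy
    have hcoord : ∀ j, b.repr y j = if j ∈ F then 0 else m j * b.repr x j := fun j => by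
      rw [hy, FunLike.coe_sub, Pi.sub_apply, map_sub, lp.coeFn_sub, Pi.sub_apply,
        b.diagonalCLM_apply_repr, b.repr_apply_apply, b.repr_apply_apply,
        b.inner_sum_smulRight_apply]
      split_ifs <;> ring
    have hpt : ∀ j, ‖b.repr y j‖ ≤ ‖(((ε : ℝ) : 𝕜) • b.repr x) j‖ := fun j => by
      rw [hcoord j, lp.coeFn_smul, Pi.smul_apply, smul_eq_mul, norm_mul, RCLike.norm_ofReal,
        abs_of_pos hε]
      split_ifs with hj
      · rw [norm_zero]; positivity
      · rw [norm_mul]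
        have : ‖m j‖ < ε := by
          by_contra h
          exact hj ((hmemF j).2 (not_lt.1 h))
        exact mul_le_mul_of_nonneg_right this.le (norm_nonneg _)
    calc ‖y‖ = ‖b.repr y‖ := (b.repr.norm_map y).symm
      _ ≤ ‖((ε : ℝ) : 𝕜) • b.repr x‖ := lp.norm_mono two_ne_zero hpt
      _ = ε * ‖x‖ := by
        rw [norm_smul, RCLike.norm_ofReal, abs_of_pos hε, b.repr.norm_map]
  -- norm limits of compact operators are compact
  choose S hSc hSn using fun k : ℕ => happrox (1 / ((k : ℝ) + 1)) (by positivity)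
  refine isCompactOperator_of_tendsto (l := atTop) (F := S) ?_ (Eventually.of_forall hSc)
  rw [tendsto_iff_norm_sub_tendsto_zero]
  refine squeeze_zero (fun k => norm_nonneg _) (fun k => ?_) tendsto_one_div_add_atTop_nhds_zero_nat
  rw [norm_sub_rev]
  exact hSn k

end HilbertBasis

end
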